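import Summits.ResolutionOfSingularities.ResolutionOfSingularities.Theorems.WeightedInvariantContactCylinderDescentStep
import HarnessLib

/-!
# MAXIMISER DESCENT at a special point of a permissible equimultiple curve — the theorem (ORDER (o28), regime P3a,
# obligation (P3a-desc) of res-L1-w43-plan-1's IOTA3-DESIGN v1 §3)
# (door `HypersurfaceCentreConstruction`, stmt-ResolutionOfSingularities-19897; KEY `stub_localWeightedDropEFT4S`)

Topic: `Summits/ResolutionOfSingularities/ResolutionOfSingularities/Theorems`. Helper for the door item
`HypersurfaceCentreConstruction` (stmt-ResolutionOfSingularities-19897, route `WeightedInvariant`), line `local-engine` of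
res-L1-w43-plan-1 (L W4.3), ORDER (o28) (lead res-type-005, co-hand res-D-brk-1).  See `…DescentLemmas` / `…DescentStep` for
the argument.  THEOREM (`exists_pair_reaches` / `exists_pair_maximiser`): `S` regular local, `P = (x, g₀)` a prime generated by
two elements of `𝔪_S` with independent differentials such that `S ⧸ P` has Krull dimension one (the P3a curve stratum — then
`S ⧸ P` is a discrete valuation ring and its VALUATION DICHOTOMY drives the integrality), `f ∈ S` EQUIMULTIPLE along `P`
(`f ∉ 𝔪_S^{ν+1}` for `ν = ord_{S_P} f`) and NOT of monomial type in `S_P`.  Then every contact level reached by `f/1` in `S_P` is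
reached by `g'/1` for a pair `(x', g') ⊆ S` of elements with independent differentials generating `P`; in particular (`S_P`
excellent) the terminal level `b_max`: THE P2 PRESENTATION OF THE CYLINDER DESCENDS TO A REGULAR PAIR OF `S`.  The
hypotheses `hxg`/`hli`/`hreach` of the cylinder VALUE (p522408) and of the (open″) body (p528319) are thereby THEOREMS at every
P3a position.  Sharpness: without equimultiplicity the top coefficient `σ_ν` need not be a unit and descent fails
(`f = (t g₀ + x²)² + t² x⁶` has maximiser `g₀ + x²/t` with no representative in `S`); without `dim S ⧸ P = 1` the quotient is
not a valuation ring.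

[OURS · L1 W4.3 · (o28) P3a]  Replaces the role of NO printed item; NOT a statement of the manuscript
[claim: Hironaka2017, status: under-review]. AI work, weaker than expert review.  Pure commutative algebra; no named facts.

## References

* H. Matsumura, *Commutative Ring Theory* (1987), Thm. 11.2, 14.2, 14.3. [Matsumura1987]
* V. Cossart, U. Jannsen, S. Saito, LNM 2270 (2020), Ch. 8 (maximal contact in dimension two). [CossartJannsenSaito2020]
* res-L1-w43-plan-1, `L/res-L1-w43-plan-1/IOTA3-DESIGN.md` v1 §3 P3a (OURS, AI planning).
-/

noncomputable section

open IsLocalRing Literature.AlgebraicGeometry.Resolution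
open Summit.ResolutionOfSingularities.ResolutionOfSingularities.Cruxes.HypersurfaceCentreConstruction.LocalEngine

set_option linter.dupNamespace false -- mandated namespace of this single-conjunct summit

namespace Summit.ResolutionOfSingularities.ResolutionOfSingularities.Theorems

namespace ContactCylinder

namespace Descent

section Main

variable {S : Type} [CommRing S] [IsRegularLocalRing S] (P : Ideal S) [P.IsPrime]

/-! ## The induction on the contact level -/

/-- **MAXIMISER DESCENT, level by level.**  `S` regular local, `P = (x, g₀)` a prime generated by a pair with independent
differentials, `S ⧸ P` with the valuation dichotomy; `f ∈ S` with `f/1 ≠ 0` NOT of monomial type in `R = S_P`, of order `ν`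
there, and EQUIMULTIPLE (`f ∉ 𝔪_S^{ν+1}`).  Then every level `c ≥ 1` reached by `f/1` in `R` is reached by `g'/1` for a pair
`(x', g') ⊆ S` with independent differentials generating `P`. [OURS · L1 W4.3 · (o28) P3a · (P3a-desc)] -/
theorem exists_pair_reaches
    (hval : ∀ a b : S, b ∉ P → ∃ c : S, a - b * c ∈ P ∨ (c ∈ maximalIdeal S ∧ b - a * c ∈ P))
    {x g₀ : S} (hxg : ∀ i, (![x, g₀] : Fin 2 → S) i ∈ maximalIdeal S)
    (hli : LinearIndependent (ResidueField S) (fun i => (maximalIdeal S).toCotangent ⟨(![x, g₀] : Fin 2 → S) i, hxg i⟩))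
    (hP : Ideal.span {x, g₀} = P) {f : S} (hf0 : algebraMap S (Localization.AtPrime P) f ≠ 0)
    (hnm : ¬ IsMonomialType (algebraMap S (Localization.AtPrime P) f))
    (heq : f ∉ maximalIdeal S ^ ((adicOrder (algebraMap S (Localization.AtPrime P) f)).toNat + 1))
    {c : ℕ} (hc : 1 ≤ c)
    (hreach : Reaches (algebraMap S (Localization.AtPrime P) f) (adicOrder (algebraMap S (Localization.AtPrime P) f)).toNat c) :
    ∃ x' g' : S, Ideal.span {x', g'} = P ∧ ∃ hxg' : ∀ i, (![x', g'] : Fin 2 → S) i ∈ maximalIdeal S,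
      LinearIndependent (ResidueField S) (fun i => (maximalIdeal S).toCotangent ⟨(![x', g'] : Fin 2 → S) i, hxg' i⟩) ∧
      algebraMap S (Localization.AtPrime P) f ∈ contactFiltration (algebraMap S (Localization.AtPrime P) g') c
        (c * (adicOrder (algebraMap S (Localization.AtPrime P) f)).toNat) := by
  haveI : IsRegularLocalRing (Localization.AtPrime P) := isRegularLocalRing_localization_atPrime S P
  obtain ⟨hmax₀, hg₀2, -, -⟩ := pair_facts P hxg hli hP
  have hg₀mem : algebraMap S (Localization.AtPrime P) g₀ ∈ maximalIdeal (Localization.AtPrime P) :=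
    hmax₀ ▸ Ideal.subset_span (by simp)
  obtain ⟨ν, -, hνnat, hν1, hfν, hford⟩ := exists_adicOrder_eq_of_not_isMonomialType hf0 hnm ⟨_, hg₀mem, hg₀2⟩
  rw [hνnat] at heq hreach ⊢
  -- induction on the level
  induction c, hc using Nat.le_induction with
  | base =>
    refine ⟨x, g₀, hP, hxg, hli, ?_⟩
    rw [one_mul, contactFiltration_one_weight hg₀mem]
    exact hfν
  | succ c hc ih =>
    obtain ⟨x₁, g₁, hP₁, hxg₁, hli₁, hreach₁⟩ := ih (hreach.of_le (Nat.le_succ c))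
    obtain ⟨γ, hγ, hγ2, hγreach⟩ := hreach
    obtain ⟨hmax, hη2, hξ2, hηξ⟩ := pair_facts P hxg₁ hli₁ hP₁
    have hξ : algebraMap S (Localization.AtPrime P) x₁ ∈ maximalIdeal (Localization.AtPrime P) :=
      hmax ▸ Ideal.subset_span (by simp)
    have hη : algebraMap S (Localization.AtPrime P) g₁ ∈ maximalIdeal (Localization.AtPrime P) :=
      hmax ▸ Ideal.subset_span (by simp)
    -- a unit added to an element of `𝔪_R` is a unit
    have hunit_add : ∀ {w n : Localization.AtPrime P}, IsUnit w → n ∈ maximalIdeal (Localization.AtPrime P) →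
        IsUnit (w + n) := by
      intro w n hw hn
      by_contra h
      have hwn : w + n ∈ maximalIdeal (Localization.AtPrime P) := (IsLocalRing.mem_maximalIdeal _).mpr h
      have : w ∈ maximalIdeal (Localization.AtPrime P) := by
        have := Ideal.sub_mem _ hwn hn
        rwa [add_sub_cancel_right] at this
      exact (IsLocalRing.mem_maximalIdeal _).mp this hw
    -- a unit multiple of a reacher is a reacher
    have hreach_of_unit_mul : ∀ {u γ' : Localization.AtPrime P}, IsUnit u → γ = u * γ' → ∀ {b n : ℕ},
        algebraMap S (Localization.AtPrime P) f ∈ contactFiltration γ b n →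
        algebraMap S (Localization.AtPrime P) f ∈ contactFiltration γ' b n := by
      intro u γ' hu hγu b n h
      rwa [hγu, contactFiltration_unit_mul hu] at h
    rcases Nat.lt_or_ge c 2 with hc1 | hc2
    · ----------------------------------------------------------------------------------------------------------------
      -- LEVEL 1 → 2: the linear direction of `γ` descends by the valuation dichotomy
      have hc1 : c = 1 := by omega
      subst hc1
      obtain ⟨α, w, hγeq⟩ := Ideal.mem_span_pair.mp (hmax.symm ▸ hγ)
      by_cases hw : IsUnit w
      · -- `γ = w (η + μ ξ)`
        set μ := α * ↑hw.unit⁻¹ with hμ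
        have hγ' : γ = w * (algebraMap S _ g₁ + μ * algebraMap S _ x₁ ^ 1) := by
          rw [← hγeq, pow_one, hμ]
          linear_combination (-(α * algebraMap S (Localization.AtPrime P) x₁)) * hw.mul_val_inv
        have hF := hreach_of_unit_mul hw hγ' hγreach
        rcases exists_or_of_dichotomy P hval μ with ⟨a, hμa⟩ | ⟨c₀, hc₀𝔪, hμc₀⟩
        · obtain ⟨hP', hxg', hli', hF'⟩ := step P hxg₁ hli₁ hP₁ le_rfl μ a hμa hF
          exact ⟨x₁, g₁ + a * x₁ ^ 1, hP', hxg', hli', hF'⟩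
        · -- `μ` is a unit with `μ⁻¹ ≡ c₀`: swap the roles of `x₁` and `g₁`
          have hμu : IsUnit μ := by
            by_contra h
            have hμm : μ ∈ maximalIdeal (Localization.AtPrime P) := (IsLocalRing.mem_maximalIdeal _).mpr h
            have : (1 : Localization.AtPrime P) ∈ maximalIdeal (Localization.AtPrime P) := by
              have h1 : μ * algebraMap S (Localization.AtPrime P) c₀ - (μ * algebraMap S (Localization.AtPrime P) c₀ - 1) ∈
                  maximalIdeal (Localization.AtPrime P) :=
                Ideal.sub_mem _ (Ideal.mul_mem_right _ _ hμm) hμc₀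
              rwa [sub_sub_cancel] at h1
            exact (IsLocalRing.mem_maximalIdeal _).mp this isUnit_one
          set μ' := (↑hμu.unit⁻¹ : Localization.AtPrime P) with hμ'
          have hγ'' : γ = (w * μ) * (algebraMap S _ x₁ + μ' * algebraMap S _ g₁ ^ 1) := by
            rw [hγ', hμ', pow_one, pow_one]
            linear_combination (-(w * algebraMap S (Localization.AtPrime P) g₁)) * hμu.mul_val_inv
          have hF' := hreach_of_unit_mul (hw.mul hμu) hγ'' hγreach
          have hμ'c₀ : μ' - algebraMap S (Localization.AtPrime P) c₀ ∈ maximalIdeal (Localization.AtPrime P) := by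
            have h1 : μ' - algebraMap S _ c₀ = -(μ' * (μ * algebraMap S _ c₀ - 1)) := by
              rw [hμ']
              linear_combination (algebraMap S (Localization.AtPrime P) c₀) * hμu.val_inv_mul
            rw [h1]
            exact neg_mem (Ideal.mul_mem_left _ _ hμc₀)
          obtain ⟨hgx₁, hli₁'⟩ := pair_swap hxg₁ hli₁
          have hP₁' : Ideal.span {g₁, x₁} = P := by rw [Ideal.span_pair_comm, hP₁]
          obtain ⟨hP', hxg', hli', hF''⟩ := step P hgx₁ hli₁' hP₁' le_rfl μ' c₀ hμ'c₀ hF'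
          exact ⟨g₁, x₁ + c₀ * g₁ ^ 1, hP', hxg', hli', hF''⟩
      · -- `w ∈ 𝔪_R`: then `α` is a unit and the roles swap, with the new coefficient in `𝔪_R`
        have hwm : w ∈ maximalIdeal (Localization.AtPrime P) := (IsLocalRing.mem_maximalIdeal _).mpr hw
        have hα : IsUnit α := by
          by_contra h
          have hαm : α ∈ maximalIdeal (Localization.AtPrime P) := (IsLocalRing.mem_maximalIdeal _).mpr h
          apply hγ2
          rw [← hγeq, pow_two]
          exact Ideal.add_mem _ (Ideal.mul_mem_mul hαm hξ) (Ideal.mul_mem_mul hwm hη)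
        set μ' := w * ↑hα.unit⁻¹ with hμ'
        have hγ' : γ = α * (algebraMap S _ x₁ + μ' * algebraMap S _ g₁ ^ 1) := by
          rw [← hγeq, pow_one, hμ']
          linear_combination (-(w * algebraMap S (Localization.AtPrime P) g₁)) * hα.mul_val_inv
        have hF := hreach_of_unit_mul hα hγ' hγreach
        have hμ'0 : μ' - algebraMap S (Localization.AtPrime P) 0 ∈ maximalIdeal (Localization.AtPrime P) := by
          rw [map_zero, sub_zero, hμ']
          exact Ideal.mul_mem_right _ _ hwm
        obtain ⟨hgx₁, hli₁'⟩ := pair_swap hxg₁ hli₁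
        have hP₁' : Ideal.span {g₁, x₁} = P := by rw [Ideal.span_pair_comm, hP₁]
        obtain ⟨hP', hxg', hli', hF'⟩ := step P hgx₁ hli₁' hP₁' le_rfl μ' 0 hμ'0 hF
        exact ⟨g₁, x₁ + 0 * g₁ ^ 1, hP', hxg', hli', hF'⟩
    · ----------------------------------------------------------------------------------------------------------------
      -- LEVEL c → c + 1, c ≥ 2: canonicity gives `γ = w' (η + μ ξ^c)`; `μ` is integral by the face identity
      set ξ := algebraMap S (Localization.AtPrime P) x₁ with hξdef
      set η := algebraMap S (Localization.AtPrime P) g₁ with hηdef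
      -- `γ` also reaches level `c`, so `γ ∈ (η) + 𝔪^c`
      have h₁ : algebraMap S (Localization.AtPrime P) f ∈ contactFiltration γ c (c * ν) :=
        contactFiltration_weight_anti γ (Nat.le_succ c) ν hγreach
      have hC2 : γ ∈ Ideal.span {η} ⊔ maximalIdeal (Localization.AtPrime P) ^ c :=
        ContactFiltration.mem_span_sup_pow_of_mem_contactFiltration hγ hη hη2 hc2 hν1 hford h₁ hreach₁
      obtain ⟨y, hy, m, hm, hym⟩ := Submodule.mem_sup.mp hC2
      obtain ⟨w, rfl⟩ := Ideal.mem_span_singleton'.mp hy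
      obtain ⟨c', rfl⟩ : ∃ c', c = c' + 1 := ⟨c - 1, by omega⟩
      have hm' : m ∈ Ideal.span {ξ ^ (c' + 1)} ⊔ Ideal.span {η} * Ideal.span {ξ, η} ^ c' := by
        rw [← hmax] at hm
        exact pow_span_pair_le ξ η c' hm
      obtain ⟨m₁, hm₁, m₂, hm₂, hm12⟩ := Submodule.mem_sup.mp hm'
      obtain ⟨μ₀, rfl⟩ := Ideal.mem_span_singleton'.mp hm₁
      obtain ⟨n, hn, rfl⟩ := Ideal.mem_span_singleton_mul.mp hm₂
      have hnm : n ∈ maximalIdeal (Localization.AtPrime P) := by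
        rw [← hmax]
        exact Ideal.pow_le_self (by omega : c' ≠ 0) hn
      have hw : IsUnit w := by
        by_contra h
        have hwm : w ∈ maximalIdeal (Localization.AtPrime P) := (IsLocalRing.mem_maximalIdeal _).mpr h
        apply hγ2
        rw [← hym]
        refine Ideal.add_mem _ ?_ (Ideal.pow_le_pow_right hc2 hm)
        rw [pow_two]
        exact Ideal.mul_mem_mul hwm hη
      have hw' : IsUnit (w + n) := hunit_add hw hnm
      set μ := μ₀ * ↑hw'.unit⁻¹ with hμ
      have hγ' : γ = (w + n) * (η + μ * ξ ^ (c' + 1)) := by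
        rw [← hym, ← hm12, hμ]
        linear_combination (-(μ₀ * ξ ^ (c' + 1))) * hw'.mul_val_inv
      have hF := hreach_of_unit_mul hw' hγ' hγreach
      set γ' := η + μ * ξ ^ (c' + 1) with hγ'def
      have hγ'm : γ' ∈ maximalIdeal (Localization.AtPrime P) :=
        Ideal.add_mem _ hη (Ideal.mul_mem_left _ _ (Ideal.pow_mem_of_mem _ hξ _ (by omega)))
      have hγ'2 : γ' ∉ maximalIdeal (Localization.AtPrime P) ^ 2 := fun h => hγ2 (hγ' ▸ Ideal.mul_mem_left _ _ h)
      have hspan' : Ideal.span {ξ, γ'} = maximalIdeal (Localization.AtPrime P) := by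
        rw [hγ'def, span_pair_add_mul_pow_eq _ _ _ (by omega : 1 ≤ c' + 1), hmax]
      -- INTEGRALITY OF `μ`.  (a) `f ∈ (x₁, g₁; 1, c)_{cν}` in `S` (contraction of the level)
      have hx𝔭 : ∀ i, (![x₁, g₁] : Fin 2 → S) i ∈ P := fun i => hP₁ ▸ Ideal.subset_span (by fin_cases i <;> simp)
      have hvec : (fun i => algebraMap S (Localization.AtPrime P) ((![x₁, g₁] : Fin 2 → S) i)) = ![ξ, η] := by
        funext i; fin_cases i <;> rfl
      have hfW : f ∈ weightedMonomialIdeal ![x₁, g₁] ![1, c' + 1] ((c' + 1) * ν) := by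
        rw [← comap_map_weightedMonomialIdeal_eq_of_linearIndependent P ![x₁, g₁] hxg₁ hli₁ hx𝔭 ![1, c' + 1]
          (Fin.forall_fin_two.2 ⟨Nat.one_pos, Nat.succ_pos c'⟩) (Nat.mul_pos (Nat.succ_pos c') hν1 : 1 ≤ (c' + 1) * ν),
          Ideal.mem_comap, weightedMonomialIdeal_map, hvec,
          ContactFiltration.weightedMonomialIdeal_eq_contactFiltration hmax (by omega : 1 ≤ c' + 1), ← contactFiltration_def]
        exact hreach₁
      -- (b) unrolling and the unit top coefficient
      obtain ⟨σ, hfσ⟩ := exists_sum_eq_of_mem_weightedMonomialIdeal_pair x₁ g₁ (c' + 1) ν hfW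
      have hσν : σ ν ∉ maximalIdeal S := not_mem_of_sum_eq_of_not_mem_pow (hxg₁ 0) (hxg₁ 1) hc2 ν σ hfσ heq
      -- (c) the face identity: `f/1 ≡ ξ^{cν} Q(μ) (mod γ')`
      set Q := ∑ j ∈ Finset.range (ν + 1), algebraMap S (Localization.AtPrime P) (σ j) * (-μ) ^ j with hQ
      have hfR : algebraMap S (Localization.AtPrime P) f =
          ∑ j ∈ Finset.range (ν + 1), algebraMap S (Localization.AtPrime P) (σ j) * ξ ^ ((c' + 1) * (ν - j)) *
            (γ' - μ * ξ ^ (c' + 1)) ^ j := by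
        rw [hfσ, map_sum]
        refine Finset.sum_congr rfl fun j _ => ?_
        rw [map_mul, map_mul, map_pow, map_pow, hγ'def, add_sub_cancel_right]
      have hface : algebraMap S (Localization.AtPrime P) f - ξ ^ ((c' + 1) * ν) * Q ∈ Ideal.span {γ'} := by
        rw [hfR, hQ]
        exact sum_sub_pow_mul_sum_mem_span_singleton ξ γ' μ (c' + 1) ν (fun j => algebraMap S _ (σ j))
      -- (d) level `c + 1`: `f/1 ∈ (γ') + (ξ^{(c+1)ν}) ⊆ (γ') + (ξ^{cν + 1})`
      have hfup : algebraMap S (Localization.AtPrime P) f ∈ Ideal.span {γ'} ⊔ Ideal.span {ξ ^ ((c' + 1) * ν + 1)} := by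
        have h1 : algebraMap S (Localization.AtPrime P) f ∈
            weightedMonomialIdeal ![ξ, γ'] ![1, c' + 1 + 1] ((c' + 1 + 1) * ν) := by
          rw [ContactFiltration.weightedMonomialIdeal_eq_contactFiltration hspan' (by omega : 1 ≤ c' + 1 + 1),
            ← contactFiltration_def]
          exact hF
        have h2 := weightedMonomialIdeal_le_span_singleton_sup_span_pow ξ γ' (c' + 1 + 1) ν h1
        have hdvd : ξ ^ ((c' + 1) * ν + 1) ∣ ξ ^ ((c' + 1 + 1) * ν) :=
          pow_dvd_pow ξ (by rw [add_one_mul (c' + 1)]; omega)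
        exact sup_le_sup_left (Ideal.span_singleton_le_span_singleton.mpr hdvd) _ h2
      have hpow : ξ ^ ((c' + 1) * ν) * Q ∈ Ideal.span {γ'} ⊔ Ideal.span {ξ ^ ((c' + 1) * ν + 1)} := by
        have : ξ ^ ((c' + 1) * ν) * Q =
            algebraMap S (Localization.AtPrime P) f - (algebraMap S (Localization.AtPrime P) f - ξ ^ ((c' + 1) * ν) * Q) := by
          ring
        rw [this]
        exact Ideal.sub_mem _ hfup (Ideal.mem_sup_left hface)
      -- (e) `(γ')` is prime and `ξ ∉ (γ')`, so `Q(μ) ∈ 𝔪_R`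
      have hγ'0 : γ' ≠ 0 := fun h => hγ'2 (by rw [h]; exact Ideal.zero_mem _)
      have hγ'prime : (Ideal.span {γ'}).IsPrime :=
        (Ideal.span_singleton_prime hγ'0).mpr (IsRegularLocalRing.prime_of_not_mem_sq hγ'm hγ'2)
      have hξγ' : ξ ∉ Ideal.span {γ'} := by
        intro h
        obtain ⟨r, hr⟩ := Ideal.mem_span_singleton'.mp h
        by_cases hru : IsUnit r
        · apply hηξ
          -- `η = r⁻¹ ξ - μ ξ^c ∈ (ξ)`
          have hηeq : η = (↑hru.unit⁻¹ - μ * ξ ^ c') * ξ := by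
            have h1 : γ' = ↑hru.unit⁻¹ * ξ := by
              rw [← hr, ← mul_assoc, IsUnit.val_inv_mul, one_mul]
            have h2 : η = γ' - μ * ξ ^ (c' + 1) := by rw [hγ'def]; ring
            rw [h2, h1, pow_succ]
            ring
          rw [hηeq]
          exact Ideal.mul_mem_left _ _ (Ideal.mem_span_singleton_self _)
        · apply hξ2
          rw [← hr, pow_two]
          exact Ideal.mul_mem_mul ((IsLocalRing.mem_maximalIdeal _).mpr hru) hγ'm
      have hQm : Q ∈ maximalIdeal (Localization.AtPrime P) := by
        have h := mem_sup_span_singleton_of_pow_mul_mem hγ'prime hξγ' ((c' + 1) * ν) hpow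
        exact sup_le ((Ideal.span_singleton_le_iff_mem (maximalIdeal _)).mpr hγ'm)
          ((Ideal.span_singleton_le_iff_mem (maximalIdeal _)).mpr hξ) h
      -- (f) the valuation dichotomy of `S ⧸ P` makes `μ` integral
      obtain ⟨a, hμa⟩ := exists_sub_algebraMap_mem_of_sum_mem P hval σ hσν μ hQm
      obtain ⟨hP', hxg', hli', hF'⟩ := step P hxg₁ hli₁ hP₁ (by omega : 1 ≤ c' + 1) μ a hμa hF
      exact ⟨x₁, g₁ + a * x₁ ^ (c' + 1), hP', hxg', hli', hF'⟩

/-! ## The terminal level: the P2 presentation descends to a regular pair of `S` -/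

/-- **MAXIMISER DESCENT (the (P3a-pres) obligation of IOTA3-DESIGN v1 §3).**  `S` regular local; `P = (x, g₀)` a prime
generated by a pair with independent differentials whose quotient `S ⧸ P` has Krull dimension ONE (the P3a curve stratum; then
`S ⧸ P` is a discrete valuation ring); `R = S_P` EXCELLENT; `f ∈ S` with `f/1 ≠ 0` NOT of monomial type in `R` and
EQUIMULTIPLE along `P` (`f ∉ 𝔪_S^{ν+1}`, `ν = ord_R (f/1)`).  Then `b_max (f/1) ≥ 1` and there is a pair `(x', g') ⊆ S` with
independent differentials, `(x', g') = P`, such that `g'/1` carries `f/1` to the terminal level `b_max` in `R`: the P2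
presentation `(x'/1, g'/1; 1, b_max)` of the cylinder comes from regular parameters of `S`.  (Feeds the hypotheses `hxg`,
`hli`, `hreach` of `cylinder_comap_eq_weightedMonomialIdeal` (p522408) and of `jOpenPresentation_body_cylinder` (p528319).)
[OURS · L1 W4.3 · (o28) P3a · (P3a-desc)] -/
theorem exists_pair_maximiser (hdim1 : ringKrullDim (S ⧸ P) = 1) {x g₀ : S}
    (hxg : ∀ i, (![x, g₀] : Fin 2 → S) i ∈ maximalIdeal S)
    (hli : LinearIndependent (ResidueField S) (fun i => (maximalIdeal S).toCotangent ⟨(![x, g₀] : Fin 2 → S) i, hxg i⟩))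
    (hP : Ideal.span {x, g₀} = P) (hexc : IsExcellentRing (Localization.AtPrime P)) {f : S}
    (hf0 : algebraMap S (Localization.AtPrime P) f ≠ 0)
    (hnm : ¬ IsMonomialType (algebraMap S (Localization.AtPrime P) f))
    (heq : f ∉ maximalIdeal S ^ ((adicOrder (algebraMap S (Localization.AtPrime P) f)).toNat + 1)) :
    1 ≤ bMax (algebraMap S (Localization.AtPrime P) f) ∧
    ∃ x' g' : S, Ideal.span {x', g'} = P ∧ ∃ hxg' : ∀ i, (![x', g'] : Fin 2 → S) i ∈ maximalIdeal S,
      LinearIndependent (ResidueField S) (fun i => (maximalIdeal S).toCotangent ⟨(![x', g'] : Fin 2 → S) i, hxg' i⟩) ∧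
      algebraMap S (Localization.AtPrime P) f ∈ contactFiltration (algebraMap S (Localization.AtPrime P) g')
        (bMax (algebraMap S (Localization.AtPrime P) f))
        (bMax (algebraMap S (Localization.AtPrime P) f) * (adicOrder (algebraMap S (Localization.AtPrime P) f)).toNat) := by
  haveI : IsRegularLocalRing (Localization.AtPrime P) := isRegularLocalRing_localization_atPrime S P
  obtain ⟨hmax₀, hg₀2, -, -⟩ := pair_facts P hxg hli hP
  have hg₀mem : algebraMap S (Localization.AtPrime P) g₀ ∈ maximalIdeal (Localization.AtPrime P) :=
    hmax₀ ▸ Ideal.subset_span (by simp)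
  have hf2 := mem_sq_of_not_isMonomialType hf0 hnm ⟨_, hg₀mem, hg₀2⟩
  obtain ⟨hb, hreach⟩ := one_le_bMax_and_reaches (Localization.AtPrime P) hexc hf0 hf2 hnm
  have hval := fun a b (_ : b ∉ P) =>
    dichotomy_of_ringKrullDim_quotient_eq_one P (isRegularLocalRing_quotient_of_pair P hxg hli hP) hdim1 a b
  exact ⟨hb, exists_pair_reaches P hval hxg hli hP hf0 hnm heq hb hreach⟩

/-- **MAXIMISER DESCENT at the door's positions** (`S` essentially of finite type over a field `k₀`, so `S_P` is excellent):
`exists_pair_maximiser` with excellence discharged. [OURS · L1 W4.3 · (o28) P3a · (P3a-desc)] -/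
theorem exists_pair_maximiser_of_essFiniteType (k₀ : Type) [Field k₀] [Algebra k₀ S] [Algebra.EssFiniteType k₀ S]
    (hdim1 : ringKrullDim (S ⧸ P) = 1) {x g₀ : S} (hxg : ∀ i, (![x, g₀] : Fin 2 → S) i ∈ maximalIdeal S)
    (hli : LinearIndependent (ResidueField S) (fun i => (maximalIdeal S).toCotangent ⟨(![x, g₀] : Fin 2 → S) i, hxg i⟩))
    (hP : Ideal.span {x, g₀} = P) {f : S} (hf0 : algebraMap S (Localization.AtPrime P) f ≠ 0)
    (hnm : ¬ IsMonomialType (algebraMap S (Localization.AtPrime P) f))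
    (heq : f ∉ maximalIdeal S ^ ((adicOrder (algebraMap S (Localization.AtPrime P) f)).toNat + 1)) :
    1 ≤ bMax (algebraMap S (Localization.AtPrime P) f) ∧
    ∃ x' g' : S, Ideal.span {x', g'} = P ∧ ∃ hxg' : ∀ i, (![x', g'] : Fin 2 → S) i ∈ maximalIdeal S,
      LinearIndependent (ResidueField S) (fun i => (maximalIdeal S).toCotangent ⟨(![x', g'] : Fin 2 → S) i, hxg' i⟩) ∧
      algebraMap S (Localization.AtPrime P) f ∈ contactFiltration (algebraMap S (Localization.AtPrime P) g')
        (bMax (algebraMap S (Localization.AtPrime P) f))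
        (bMax (algebraMap S (Localization.AtPrime P) f) * (adicOrder (algebraMap S (Localization.AtPrime P) f)).toNat) :=
  have hk : IsExcellentRing k₀ := Stacks07QW_field_holds k₀ k₀ inferInstance
  exists_pair_maximiser P hdim1 hxg hli hP (hk.of_essFiniteType inferInstance) hf0 hnm heq

end Main

end Descent

end ContactCylinder

end Summit.ResolutionOfSingularities.ResolutionOfSingularities.Theorems

end
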